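import Summits.Schanuel.Schanuel.Theorems.SoloInformedIrreducibleIterateDerivative

/-!
# Divided derivatives, a primitive common divisor of them, and its radical

Soloist file (informed mode, seat `solo-Schanuel-informed`, s180).  Bookkeeping for the seat's
THEOREMS AE-1τ / AE-2 (`paper/AE-note.md` §8 (R3) and §9 (a)–(b), `η = 0` node forms) on the
node `RoyAdditiveDirichletExponent` ([cite: Roy2010, Thm 1.1]); the mechanism is D. Roy's
"radical of the gcd of the divided derivatives" step ([cite: Roy2010, §1 p. 4, step (3)]), no
novelty is claimed.

Part A — divided (Hasse) derivatives `P^{[j]} = hasseDeriv j P`: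
* `soloDG_hasseDeriv_hasseDeriv`: `(P^{[l]})^{[k]} = C(k+l, k) • P^{[k+l]}` (Mathlib's
  `hasseDeriv_comp` evaluated at `P`), whence the value bound
  `‖(P^{[l]})^{[k]}(z)‖ ≤ 2^(k+l) ‖P^{[k+l]}(z)‖`
  (`soloDG_norm_aeval_hasseDeriv_hasseDeriv_le`);
* `soloDG_supNorm_hasseDeriv_le`: `‖P^{[j]}‖_∞ ≤ 2^(deg P) ‖P‖_∞` for `P ∈ ℤ[X]`;
* `soloDG_hasseDeriv_ne_zero`: `P^{[j]} ≠ 0` for `j ≤ deg P`, `P ≠ 0`;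
* `soloDG_iterate_derivative_eq_factorial_smul`: `P^(j) = j! • P^{[j]}`, so a divisor of
  `P^{[j]}` divides `P^(j)` (`soloDG_dvd_iterate_derivative`).

Part B — let `Q ∈ ℤ[X]` be PRIMITIVE with `Q ∣ P^{[j]}` for all `j < t` (for instance the
primitive part of the gcd of `P^{[0]}, …, P^{[t-1]}`,
`soloDG_primPart_gcd_hasseDeriv_dvd`), and
let `R = radical Q` (Mathlib's `UniqueFactorizationMonoid.radical` in the UFD `ℤ[X]`).  Then
* `soloDG_radical_pow_dvd`: `R ^ t ∣ P` in `ℤ[X]` — prime factor by prime factor: a prime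
  factor `p` of `Q` is primitive, hence irreducible over `ℚ` (Gauss), the tree's
  `soloID_pow_dvd_of_dvd_iterate_derivative` gives `p^t ∣ P` over `ℚ`, Gauss's lemma
  (`IsPrimitive.Int.dvd_iff_map_cast_dvd_map_cast`) brings it back to `ℤ[X]`, and the pairwise
  relatively prime powers multiply (`Finset.prod_dvd_of_isRelPrime`);
* consequences: `t · deg R ≤ deg P` (`soloDG_mul_natDegree_radical_le`) and
  `M(R)^t ≤ M(P)` for the Mahler measures over `ℂ` (`soloDG_mahlerMeasure_radical_pow_le`; the
  integer cofactor has `M ≥ 1`);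
* `soloDG_aeval_radical_eq_zero`: every complex root of `Q` is a root of `R`
  (`Q ∣ R^m`, Mathlib's `exists_dvd_radical_self_pow`), and a root of an integer polynomial is
  hit by any enumeration of its roots (`soloDG_exists_index_of_aeval_eq_zero`).

What this is NOT.  No small value estimate is proved here and nothing bears on
`Literature.Periods.SchanuelConjecture` (the seat's verdict, no path, is unchanged); the node
[cite: Roy2010, Thm 1.1] is not claimed.  Tree files and Mathlib only; no definitions, no
literature hypothesis; axioms the standard three.
-/

namespace Summit.Schanuel.Schanuel.Theorems

open Polynomial Finset UniqueFactorizationMonoid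

/-! ### Part A. Divided derivatives -/

/-- Composition of divided derivatives: `(P^{[l]})^{[k]} = C(k+l, k) • P^{[k+l]}`. -/
theorem soloDG_hasseDeriv_hasseDeriv {R : Type*} [Semiring R] (P : R[X]) (k l : ℕ) :
    hasseDeriv k (hasseDeriv l P) = (k + l).choose k • hasseDeriv (k + l) P := by
  have h := LinearMap.congr_fun (hasseDeriv_comp (R := R) k l) P
  simpa only [LinearMap.comp_apply, LinearMap.smul_apply] using h

/-- Value bound for a composed divided derivative:
`‖(P^{[l]})^{[k]}(z)‖ ≤ 2^(k+l) · ‖P^{[k+l]}(z)‖` (`C(k+l, k) ≤ 2^(k+l)`). -/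
theorem soloDG_norm_aeval_hasseDeriv_hasseDeriv_le (P : ℤ[X]) (z : ℂ) (k l : ℕ) :
    ‖aeval z (hasseDeriv k (hasseDeriv l P))‖ ≤
      2 ^ (k + l) * ‖aeval z (hasseDeriv (k + l) P)‖ := by
  rw [soloDG_hasseDeriv_hasseDeriv, map_nsmul, nsmul_eq_mul, norm_mul, Complex.norm_natCast]
  have h : (((k + l).choose k : ℕ) : ℝ) ≤ 2 ^ (k + l) := by
    exact_mod_cast Nat.choose_le_two_pow (k + l) k
  exact mul_le_mul_of_nonneg_right h (norm_nonneg _)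

/-- Coefficient bound: every coefficient of `P^{[j]}` has modulus `≤ 2^(deg P) · ‖P‖_∞`. -/
theorem soloDG_norm_coeff_hasseDeriv_le (P : ℤ[X]) (j i : ℕ) :
    ‖(hasseDeriv j P).coeff i‖ ≤ 2 ^ P.natDegree * P.supNorm := by
  have h0 : 0 ≤ (2 : ℝ) ^ P.natDegree * P.supNorm :=
    mul_nonneg (pow_nonneg (by norm_num) _) P.supNorm_nonneg
  rw [hasseDeriv_coeff]
  by_cases hle : i + j ≤ P.natDegree
  · have hc : ‖P.coeff (i + j)‖ ≤ P.supNorm := P.le_supNorm (i + j)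
    rw [Int.norm_eq_abs] at hc
    rw [Int.norm_eq_abs, Int.cast_mul, Int.cast_natCast, abs_mul, Nat.abs_cast]
    have h1 : (((i + j).choose j : ℕ) : ℝ) ≤ 2 ^ (i + j) := by
      exact_mod_cast Nat.choose_le_two_pow (i + j) j
    have h2 : (2 : ℝ) ^ (i + j) ≤ 2 ^ P.natDegree := pow_le_pow_right₀ (by norm_num) hle
    calc (((i + j).choose j : ℕ) : ℝ) * |((P.coeff (i + j) : ℤ) : ℝ)|
        ≤ 2 ^ P.natDegree * |((P.coeff (i + j) : ℤ) : ℝ)| :=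
          mul_le_mul_of_nonneg_right (h1.trans h2) (abs_nonneg _)
      _ ≤ 2 ^ P.natDegree * P.supNorm :=
          mul_le_mul_of_nonneg_left hc (pow_nonneg (by norm_num) _)
  · have hc : P.coeff (i + j) = 0 := coeff_eq_zero_of_natDegree_lt (by omega)
    rw [hc, mul_zero, norm_zero]
    exact h0

/-- Height bound: `‖P^{[j]}‖_∞ ≤ 2^(deg P) · ‖P‖_∞` for an integer polynomial `P`. -/
theorem soloDG_supNorm_hasseDeriv_le (P : ℤ[X]) (j : ℕ) :
    (hasseDeriv j P).supNorm ≤ 2 ^ P.natDegree * P.supNorm := by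
  obtain ⟨i, hi⟩ := (hasseDeriv j P).exists_eq_supNorm
  rw [hi]
  exact soloDG_norm_coeff_hasseDeriv_le P j i

/-- Non-vanishing: `P^{[j]} ≠ 0` for `P ≠ 0` and `j ≤ deg P` (its coefficient of degree
`deg P - j` is `C(deg P, j) · lc(P) ≠ 0`). -/
theorem soloDG_hasseDeriv_ne_zero {P : ℤ[X]} (hP : P ≠ 0) {j : ℕ} (hj : j ≤ P.natDegree) :
    hasseDeriv j P ≠ 0 := by
  intro h
  have hc := congr_arg (fun Q : ℤ[X] => Q.coeff (P.natDegree - j)) h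
  simp only [hasseDeriv_coeff, coeff_zero, Nat.sub_add_cancel hj] at hc
  rcases mul_eq_zero.mp hc with h1 | h2
  · exact (Nat.choose_pos hj).ne' (by exact_mod_cast h1)
  · exact hP (leadingCoeff_eq_zero.mp h2)

/-- `P^(j) = j! • P^{[j]}` (Mathlib's `factorial_smul_hasseDeriv` evaluated at `P`). -/
theorem soloDG_iterate_derivative_eq_factorial_smul {R : Type*} [Semiring R] (P : R[X])
    (j : ℕ) : derivative^[j] P = j.factorial • hasseDeriv j P := by
  have h := congr_fun (factorial_smul_hasseDeriv (R := R) (k := j)) P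
  rw [← h, LinearMap.smul_apply]

/-- A divisor of `P^{[j]}` divides the ordinary iterated derivative `P^(j)`. -/
theorem soloDG_dvd_iterate_derivative {R : Type*} [CommRing R] {Q P : R[X]} {j : ℕ}
    (h : Q ∣ hasseDeriv j P) : Q ∣ derivative^[j] P := by
  rw [soloDG_iterate_derivative_eq_factorial_smul, nsmul_eq_mul]
  exact h.mul_left _

/-- The primitive part of the gcd of the divided derivatives `P^{[i]}`, `i < t`, divides each of
them (this is the polynomial `Q` of [cite: Roy2010, Cor 3.2] for that family). -/
theorem soloDG_primPart_gcd_hasseDeriv_dvd (P : ℤ[X]) (t : ℕ) {j : ℕ} (hj : j < t) :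
    ((univ : Finset (Fin t)).gcd fun i => hasseDeriv (i : ℕ) P).primPart ∣ hasseDeriv j P := by
  have h1 : ((univ : Finset (Fin t)).gcd fun i => hasseDeriv (i : ℕ) P) ∣
      hasseDeriv ((⟨j, hj⟩ : Fin t) : ℕ) P :=
    Finset.gcd_dvd (Finset.mem_univ (⟨j, hj⟩ : Fin t))
  exact dvd_trans (primPart_dvd _) h1

/-! ### Part B. The radical of a primitive common divisor of the divided derivatives -/

/-- Powers of a primitive polynomial are primitive. -/
theorem soloDG_isPrimitive_pow {p : ℤ[X]} (hp : p.IsPrimitive) (t : ℕ) :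
    (p ^ t).IsPrimitive := by
  induction t with
  | zero => rw [pow_zero]; exact isPrimitive_one
  | succ t ih => rw [pow_succ]; exact ih.mul hp

/-- A prime factor `p` of a primitive `Q` with `Q ∣ P^{[j]}` for all `j < t` satisfies `p^t ∣ P`
in `ℤ[X]`: `p` is primitive and irreducible, hence irreducible over `ℚ` (Gauss); over `ℚ` the
tree's `soloID_pow_dvd_of_dvd_iterate_derivative` applies; Gauss's lemma returns to `ℤ[X]`. -/
theorem soloDG_pow_dvd_of_mem_primeFactors {P Q p : ℤ[X]} (hQ : Q.IsPrimitive)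
    (hp : p ∈ primeFactors Q) {t : ℕ} (hdvd : ∀ j < t, Q ∣ hasseDeriv j P) :
    p ^ t ∣ P := by
  rw [mem_primeFactors] at hp
  have hpQ : p ∣ Q := dvd_of_mem_normalizedFactors hp
  have hpirr : Irreducible p := irreducible_of_normalized_factor p hp
  have hpprim : p.IsPrimitive := isPrimitive_of_dvd hQ hpQ
  have hpirr' : Irreducible (p.map (Int.castRingHom ℚ)) :=
    (IsPrimitive.Int.irreducible_iff_irreducible_map_cast hpprim).mp hpirr
  have hdiv : ∀ j < t,
      p.map (Int.castRingHom ℚ) ∣ derivative^[j] (P.map (Int.castRingHom ℚ)) := by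
    intro j hj
    rw [iterate_derivative_map]
    exact Polynomial.map_dvd _ (soloDG_dvd_iterate_derivative (hpQ.trans (hdvd j hj)))
  have hpow := soloID_pow_dvd_of_dvd_iterate_derivative hpirr' t _ hdiv
  rw [← Polynomial.map_pow] at hpow
  exact (IsPrimitive.Int.dvd_iff_map_cast_dvd_map_cast (p ^ t) P
    (soloDG_isPrimitive_pow hpprim t)).mpr hpow

/-- **(R3) in `ℤ[X]`.** If `Q` is primitive and `Q ∣ P^{[j]}` for all `j < t`, then
`(radical Q) ^ t ∣ P`. -/
theorem soloDG_radical_pow_dvd {P Q : ℤ[X]} (hQ : Q.IsPrimitive) {t : ℕ}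
    (hdvd : ∀ j < t, Q ∣ hasseDeriv j P) : radical Q ^ t ∣ P := by
  rw [radical, ← Finset.prod_pow]
  apply Finset.prod_dvd_of_isRelPrime
  · intro p hp q hq hpq
    exact (pairwise_primeFactors_isRelPrime hp hq hpq).pow
  · intro p hp
    exact soloDG_pow_dvd_of_mem_primeFactors hQ hp hdvd

/-- Degree consequence of (R3): `t · deg (radical Q) ≤ deg P` when `P ≠ 0`. -/
theorem soloDG_mul_natDegree_radical_le {P Q : ℤ[X]} (hQ : Q.IsPrimitive) {t : ℕ}
    (hdvd : ∀ j < t, Q ∣ hasseDeriv j P) (hP0 : P ≠ 0) :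
    t * (radical Q).natDegree ≤ P.natDegree := by
  have h := natDegree_le_of_dvd (soloDG_radical_pow_dvd hQ hdvd) hP0
  rwa [natDegree_pow] at h

/-- Mahler measure of a power (Mathlib has the product rule `mahlerMeasure_mul`). -/
theorem soloDG_mahlerMeasure_pow (p : ℂ[X]) (t : ℕ) :
    (p ^ t).mahlerMeasure = p.mahlerMeasure ^ t := by
  induction t with
  | zero => rw [pow_zero, pow_zero, mahlerMeasure_one]
  | succ t ih => rw [pow_succ, pow_succ, mahlerMeasure_mul, ih]

/-- Mahler-measure consequence of (R3): `M(radical Q)^t ≤ M(P)` over `ℂ` when `P ≠ 0` (the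
integer cofactor `G` in `P = (radical Q)^t · G` has `M(G) ≥ 1`). -/
theorem soloDG_mahlerMeasure_radical_pow_le {P Q : ℤ[X]} (hQ : Q.IsPrimitive) {t : ℕ}
    (hdvd : ∀ j < t, Q ∣ hasseDeriv j P) (hP0 : P ≠ 0) :
    ((radical Q).map (Int.castRingHom ℂ)).mahlerMeasure ^ t ≤
      (P.map (Int.castRingHom ℂ)).mahlerMeasure := by
  obtain ⟨G, hG⟩ := soloDG_radical_pow_dvd hQ hdvd
  have hG0 : G ≠ 0 := by
    rintro rfl
    exact hP0 (by rw [hG, mul_zero])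
  have h1 : 1 ≤ (G.map (Int.castRingHom ℂ)).mahlerMeasure :=
    one_le_mahlerMeasure_of_ne_zero hG0
  rw [hG, Polynomial.map_mul, Polynomial.map_pow, mahlerMeasure_mul, soloDG_mahlerMeasure_pow]
  exact le_mul_of_one_le_right (pow_nonneg (mahlerMeasure_nonneg _) _) h1

/-- The radical of a non-zero integer polynomial vanishes at each of its complex roots
(`Q ∣ (radical Q)^m` for some `m`). -/
theorem soloDG_aeval_radical_eq_zero {Q : ℤ[X]} (hQ0 : Q ≠ 0) {z : ℂ} (hz : aeval z Q = 0) :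
    aeval z (radical Q) = 0 := by
  obtain ⟨m, hm⟩ := exists_dvd_radical_self_pow hQ0
  have h : aeval z (radical Q ^ m) = 0 := by
    obtain ⟨c, hc⟩ := hm
    rw [hc, map_mul, hz, zero_mul]
  rw [map_pow] at h
  exact eq_zero_of_pow_eq_zero h

/-- The radical of an integer polynomial is non-zero and, if `Q ≠ 0` has a complex root, has
positive degree. -/
theorem soloDG_natDegree_radical_pos {Q : ℤ[X]} (hQ0 : Q ≠ 0) {z : ℂ} (hz : aeval z Q = 0) :
    0 < (radical Q).natDegree := by
  by_contra h
  have h0 : (radical Q).natDegree = 0 := by omega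
  have hR := soloDG_aeval_radical_eq_zero hQ0 hz
  rw [eq_C_of_natDegree_eq_zero h0, aeval_C, algebraMap_int_eq, eq_intCast,
    Int.cast_eq_zero] at hR
  have hR0 : radical Q ≠ 0 := radical_ne_zero
  apply hR0
  rw [eq_C_of_natDegree_eq_zero h0, hR, C_0]

/-- A complex root of a non-zero integer polynomial `F` is hit by every enumeration `ρ` of the
roots of `F` (`univ.val.map ρ = roots`). -/
theorem soloDG_exists_index_of_aeval_eq_zero (F : ℤ[X]) (hF : F ≠ 0) {D : ℕ}
    (ρ : Fin D → ℂ) (hρ : univ.val.map ρ = (F.map (Int.castRingHom ℂ)).roots) {z : ℂ}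
    (hz : aeval z F = 0) :
    ∃ k : Fin D, ρ k = z := by
  have hF' : F.map (Int.castRingHom ℂ) ≠ 0 :=
    (Polynomial.map_ne_zero_iff Int.cast_injective).mpr hF
  have hmem : z ∈ (F.map (Int.castRingHom ℂ)).roots := by
    rw [mem_roots hF', IsRoot.def, eval_map, ← algebraMap_int_eq, ← aeval_def]
    exact hz
  rw [← hρ, Multiset.mem_map] at hmem
  obtain ⟨k, -, hk⟩ := hmem
  exact ⟨k, hk⟩

end Summit.Schanuel.Schanuel.Theorems
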